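/-
Copyright (c) 2026 the pub-hodgecm-mathlib formalisation cell (harness21).  Prover seat hodgecm-mathlib-LH10-p02 (g15); E1 keeper ∕ dealer F0P3a-p03 (g31)
k104 «ROW 78 (X2a)» on the EXT-ROAD census of LH6-p04 (g12) (`CENSUS-P1261bRest-ExtRoad.v1` 85875cce, brick (X2a) «generic eigenspace-exactness»).
-/
import Literature.LinearAlgebra.PrimaryDecompositionCommutingFamily   -- ★ `CommutingFamily.map_iInf_maxGenEigenspace_le_of_comp_eq`, `.apply_mem_iInf_maxGenEigenspace_of_forall_commute`, `.iSupIndep_iInf_maxGenEigenspace`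
import Mathlib.LinearAlgebra.Eigenspace.Pi
import Mathlib.LinearAlgebra.Eigenspace.Triangularizable
import Mathlib.LinearAlgebra.Projection
import Mathlib.RingTheory.Artinian.Module
import HarnessLib

/-!
# Joint generalised eigenspaces of a commuting family, ARBITRARY index set: joint eigenvectors, short-exactness, and extension of eigen-functionals

Generic linear algebra over a field `K` (`IsAlgClosed K` + finite dimension only where the blocks must SPAN; Mathlib + the tree's ★
`Literature/LinearAlgebra/PrimaryDecompositionCommutingFamily` only; THEOREMS ONLY — no definition, no instance, no named fact).  Namespace
`Literature.LinearAlgebra.CommutingFamily` (the tree's, continued).  Cell `pub/hodgecm-mathlib`, crux H413 = `stmt-HodgeConjecture-24833` (`--supports` lane, count-neutral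
helper); E1 row 78 = brick (X2a) of the EXT-ROAD «12.6.1 (b)-REST VIA THE EP DEFECT + BLOCK SEPARATION» (LH6-p04 (g12)): the linear algebra of the finite-dimensional
Jacquet module `r_B E` of an extension `0 → π′ → E → π → 0`, as a module over the torus `T` — an INFINITE commuting family, which is why the tree's `Finset`∕`Finite ι`
forms (★ `CommutingFamilyFittingProjection`, ★ `iInf_eigenspace_ne_bot`) are complemented here by ARBITRARY-`ι` forms in finite dimension.

SETTING.  `f : ι → Module.End K V` a family of endomorphisms (consumer: `ι := ↥t.M`, `f := ⇑(ρ.normalizedJacquet t)` — a `Representation` coerces to such a family),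
`χ : ι → K` a «character»; the JOINT GENERALISED EIGENSPACE («`χ`-block») is spelt `⨅ i, (f i).maxGenEigenspace (χ i)` as in Mathlib `LinearAlgebra/Eigenspace/Pi` and
the tree (no new definition).  Maps between families `f₁, f₂` are linear maps `F` with `∀ i, F ∘ₗ f₁ i = f₂ i ∘ₗ F` (the tree's currency = Mathlib
`Representation.IntertwiningMap.isIntertwining'`).  Commutativity is `∀ i j, Commute (f i) (f j)` (for a representation of a commutative monoid: `σ m * σ m' = σ (m*m')`).

RESULTS (★ = reused BY NAME from the tree, not restated: functoriality `map_iInf_maxGenEigenspace_le_of_comp_eq`, stability `apply_mem_iInf_maxGenEigenspace_of_forall_commute`,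
independence `iSupIndep_iInf_maxGenEigenspace`).
* §0 bookkeeping: powers of `a − c•1` along an intertwiner ∕ along a `χ`-eigen-functional.
* §1 `iInf_maxGenEigenspace_eq_comap_of_comp_eq_of_injective` — along an INJECTIVE intertwiner the block is the PREIMAGE of the block.
* §2 **`exists_eigenvector_of_iInf_maxGenEigenspace_ne_bot`** — a non-zero `χ`-block of a commuting family (ANY `ι`) on a finite-dimensional space contains a JOINT
  EIGENVECTOR (`f i w = χ i • w`, `w ≠ 0`); no algebraic closure (a minimal non-zero stable submodule of the block is killed by every `f i − χ i`).  With the converse: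
  «JOINT EIGENVECTOR ⇔ BLOCK ≠ 0» (`iInf_maxGenEigenspace_ne_bot_iff_exists_eigenvector`), whose right-hand side is the body of ★ `Representation.hasJacquetExponent_iff`.
* §3 `eigenFunctional_eq_zero_of_mem_iInf_maxGenEigenspace` — a `χ`-eigen-FUNCTIONAL (`Λ (f i v) = χ i * Λ v`) kills every `ψ`-block, `ψ ≠ χ` (and their span).
* §4 spanning in finite dimension over an algebraically closed field (Mathlib), the COMPLEMENT of a block (`isCompl_iInf_maxGenEigenspace_iSup_ne`), and
  **`map_iInf_maxGenEigenspace_eq_of_comp_eq_of_surjective`** — along a SURJECTIVE intertwiner of commuting families the image of the `χ`-block IS the `χ`-block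
  (ANY `ι`; the tree's ★ `map_biInf_maxGenEigenspace_eq_of_comp_eq` is the `Finset`-indexed finite-length form); with §1 and `exists_mem_iInf_maxGenEigenspace_map_eq_of_exact`
  this is the SHORT-EXACTNESS of `V ↦ χ`-block.
* §5 **`exists_eigenFunctional_extension`** — THE EXTENSION LEMMA the road's datum file (X2) calls: `V₁ →F V₂ →G V₃`, `F` injective, `Function.Exact F G`, `G` surjective,
  `f₂` commuting, `V₂` finite-dimensional over an algebraically closed field, `lam : V₁ → K` a `χ`-eigen-functional and NO `χ`-eigenvector in `V₃` ⇒ `lam` extends to a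
  `χ`-eigen-functional `Λ` of `V₂` with `Λ ∘ F = lam` («the `χ′`-quotient functional of `r_B π′` extends `T`-equivariantly to `r_B E` when `χ′` is not an exponent of `π`»).
HONEST LABEL: count-neutral generic helper; nothing printed is asserted; the EXT-ROAD is a road CANDIDATE pending the LEAD's price; h413 OPEN; HC_CM is proved only modulo
the 7 printed citations (2 remaining named inputs hLiu418 = stmt-HodgeConjecture-24832, h413 = stmt-HodgeConjecture-24833) until rung 0 closes.

## References
* [BernsteinZelevinsky1977] I. N. Bernstein, A. V. Zelevinsky, *Induced representations of reductive p-adic groups I*, Ann. Sci. ÉNS 10 (1977), §2.3 (exponents; Jacquet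
  modules as finite-dimensional modules over the torus).
* [Casselman1995] W. Casselman, *Introduction to the theory of admissible representations of p-adic reductive groups* (draft 1995), §3.2 Prop. 3.2.3, §4.4 p. 45
  (`(V_N)_{χ,∞}`: generalised eigenspaces of the split component on Jacquet modules), §6.3.
* [KnappVogan1995] A. W. Knapp, D. A. Vogan, *Cohomological Induction and Unitary Representations* (1995), §VII.2 Prop. 7.20, Cor. 7.27 (primary decomposition, joint
  eigenvectors) — the tree's ★ `PrimaryDecompositionCommutingFamily`.
-/

set_option autoImplicit false

namespace Literature.LinearAlgebra.CommutingFamily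

open Function Set Module Module.End

variable {K : Type*} [Field K] {ι : Type*}
  {V : Type*} [AddCommGroup V] [Module K V]
  {V₁ : Type*} [AddCommGroup V₁] [Module K V₁]
  {V₂ : Type*} [AddCommGroup V₂] [Module K V₂]
  {V₃ : Type*} [AddCommGroup V₃] [Module K V₃]

/-! ## §0 Bookkeeping: powers of `a − c•1` along an intertwiner and along an eigen-functional -/

/-- Along a linear map intertwining `a` and `b` (`F ∘ a = b ∘ F`), powers of `a − c•1` go to powers of `b − c•1`, pointwise. [cite: Casselman1995, §3.2 Prop. 3.2.3] -/
theorem apply_sub_smul_one_pow_eq (F : V₁ →ₗ[K] V₂) {a : Module.End K V₁} {b : Module.End K V₂} (hF : F ∘ₗ a = b ∘ₗ F) (c : K) (n : ℕ) (v : V₁) :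
    F (((a - c • (1 : Module.End K V₁)) ^ n) v) = ((b - c • (1 : Module.End K V₂)) ^ n) (F v) := by
  have hF' : ∀ v, F (a v) = b (F v) := fun v => LinearMap.congr_fun hF v
  induction n generalizing v with
  | zero => simp
  | succ n ih =>
    rw [pow_succ, pow_succ, Module.End.mul_apply, Module.End.mul_apply, ih]
    simp only [LinearMap.sub_apply, LinearMap.smul_apply, Module.End.one_apply, map_sub, map_smul, hF']

/-- Along a `χ`-eigen-functional `Λ` of one operator (`Λ (a v) = χa * Λ v`): `Λ ((a − c•1)ⁿ v) = (χa − c)ⁿ * Λ v`. [cite: Casselman1995, §4.4 p. 45] -/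
theorem eigenFunctional_apply_sub_smul_one_pow (Λ : V →ₗ[K] K) {a : Module.End K V} {χa : K} (hΛ : ∀ v, Λ (a v) = χa * Λ v) (c : K) (n : ℕ) (v : V) :
    Λ (((a - c • (1 : Module.End K V)) ^ n) v) = (χa - c) ^ n * Λ v := by
  induction n generalizing v with
  | zero => simp
  | succ n ih =>
    rw [pow_succ, pow_succ, Module.End.mul_apply, ih]
    simp only [LinearMap.sub_apply, LinearMap.smul_apply, Module.End.one_apply, map_sub, map_smul, hΛ, smul_eq_mul]
    ring

/-! ## §1 Along an injective intertwiner the block is the preimage of the block -/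

/-- **Along an INJECTIVE intertwiner `F` (`F ∘ f₁ i = f₂ i ∘ F`) the `χ`-block of the source is the PREIMAGE of the `χ`-block of the target** (`≤` is the tree's ★
functoriality `map_iInf_maxGenEigenspace_le_of_comp_eq`; `≥` needs injectivity: `F ((f₁ i − χ i)ⁿ v) = (f₂ i − χ i)ⁿ (F v) = 0`).
[cite: BernsteinZelevinsky1977, §2.3] [cite: Casselman1995, §3.2 Prop. 3.2.3] -/
theorem iInf_maxGenEigenspace_eq_comap_of_comp_eq_of_injective (f₁ : ι → Module.End K V₁) (f₂ : ι → Module.End K V₂) (F : V₁ →ₗ[K] V₂)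
    (hF : ∀ i, F ∘ₗ f₁ i = f₂ i ∘ₗ F) (hinj : Function.Injective F) (χ : ι → K) :
    (⨅ i, (f₁ i).maxGenEigenspace (χ i)) = (⨅ i, (f₂ i).maxGenEigenspace (χ i)).comap F := by
  refine le_antisymm (fun v hv => map_iInf_maxGenEigenspace_le_of_comp_eq f₁ f₂ F hF χ ⟨v, hv, rfl⟩) (fun v hv => ?_)
  rw [Submodule.mem_comap, Module.End.mem_iInf_maxGenEigenspace_iff] at hv
  rw [Module.End.mem_iInf_maxGenEigenspace_iff]
  intro j
  obtain ⟨n, hn⟩ := hv j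
  refine ⟨n, hinj ?_⟩
  rw [apply_sub_smul_one_pow_eq F (hF j) (χ j) n v, hn, map_zero]

/-! ## §2 Joint eigenvector ⇔ non-zero block (commuting family, ANY index set, finite dimension; no algebraic closure) -/

/-- A joint eigenvector with «character» `χ` lies in the `χ`-block, which is therefore non-zero. [cite: Casselman1995, §4.4 p. 45] -/
theorem iInf_maxGenEigenspace_ne_bot_of_eigenvector (f : ι → Module.End K V) (χ : ι → K) {w : V} (hw : w ≠ 0) (he : ∀ i, f i w = χ i • w) :
    (⨅ i, (f i).maxGenEigenspace (χ i)) ≠ ⊥ := by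
  rw [Submodule.ne_bot_iff]
  refine ⟨w, ?_, hw⟩
  rw [Module.End.mem_iInf_maxGenEigenspace_iff]
  intro j
  refine ⟨1, ?_⟩
  simp only [pow_one, LinearMap.sub_apply, LinearMap.smul_apply, Module.End.one_apply, he j, sub_self]

/-- **A NON-ZERO BLOCK OF A COMMUTING FAMILY (ANY INDEX SET) ON A FINITE-DIMENSIONAL SPACE CONTAINS A JOINT EIGENVECTOR.**  If the `f i` pairwise commute and the
`χ`-block `⨅ i, (f i).maxGenEigenspace (χ i)` is non-zero, there is `w ≠ 0` in it with `f i w = χ i • w` for every `i`.  Proof: among the non-zero submodules of the block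
stable under every `f i` (the block itself is one, ★ `apply_mem_iInf_maxGenEigenspace_of_forall_commute`) pick a MINIMAL one `W` (Artinian); for each `i`,
`W ⊓ ker (f i − χ i)` is again stable (commutation) and non-zero (else `f i − χ i` is injective on `W`, so every iterate of a non-zero `x ∈ W` is non-zero — but some
iterate vanishes since `x` is in the block), hence `= W`.  The tree's ★ `iInf_eigenspace_ne_bot` (Cor. 7.27) is the `Finite ι` form; the torus of a `p`-adic group is an
infinite family. [cite: KnappVogan1995, §VII.2 Cor. 7.27] [cite: Casselman1995, §4.4 p. 45] [cite: BernsteinZelevinsky1977, §2.3] -/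
theorem exists_eigenvector_of_iInf_maxGenEigenspace_ne_bot [FiniteDimensional K V] (f : ι → Module.End K V) (hc : ∀ i j, Commute (f i) (f j)) (χ : ι → K)
    (hne : (⨅ i, (f i).maxGenEigenspace (χ i)) ≠ ⊥) :
    ∃ w : V, w ≠ 0 ∧ w ∈ (⨅ i, (f i).maxGenEigenspace (χ i)) ∧ ∀ i, f i w = χ i • w := by
  -- the non-zero submodules of the block stable under the family
  let S : Set (Submodule K V) := {W | W ≤ (⨅ i, (f i).maxGenEigenspace (χ i)) ∧ W ≠ ⊥ ∧ ∀ i, ∀ x ∈ W, f i x ∈ W}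
  have hES : (⨅ i, (f i).maxGenEigenspace (χ i)) ∈ S :=
    ⟨le_rfl, hne, fun i x hx => apply_mem_iInf_maxGenEigenspace_of_forall_commute f (fun j => hc j i) χ hx⟩
  obtain ⟨W, ⟨hWE, hWne, hWst⟩, hWmin⟩ := IsArtinian.set_has_minimal S ⟨_, hES⟩
  -- every `f i − χ i` kills the minimal `W`
  have hkill : ∀ i, ∀ x ∈ W, f i x = χ i • x := by
    intro i
    let N : Submodule K V := W ⊓ LinearMap.ker (f i - χ i • (1 : Module.End K V))
    have hNst : ∀ j, ∀ x ∈ N, f j x ∈ N := by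
      intro j x hx
      obtain ⟨hxW, hxker⟩ := Submodule.mem_inf.1 hx
      refine Submodule.mem_inf.2 ⟨hWst j x hxW, ?_⟩
      rw [LinearMap.mem_ker] at hxker ⊢
      have hcomm : (f i - χ i • (1 : Module.End K V)) (f j x) = f j ((f i - χ i • (1 : Module.End K V)) x) := by
        simp only [LinearMap.sub_apply, LinearMap.smul_apply, Module.End.one_apply, map_sub, map_smul]
        rw [← Module.End.mul_apply, (hc i j).eq, Module.End.mul_apply]
      rw [hcomm, hxker, map_zero]
    have hNne : N ≠ ⊥ := by
      intro hN
      obtain ⟨x, hxW, hx0⟩ := (Submodule.ne_bot_iff W).1 hWne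
      have hxE := hWE hxW
      rw [Module.End.mem_iInf_maxGenEigenspace_iff] at hxE
      obtain ⟨n, hn⟩ := hxE i
      -- all iterates of `x` under `f i − χ i` are non-zero members of `W`
      have iter : ∀ j : ℕ, ((f i - χ i • (1 : Module.End K V)) ^ j) x ∈ W ∧ ((f i - χ i • (1 : Module.End K V)) ^ j) x ≠ 0 := by
        intro j
        induction j with
        | zero => exact ⟨by simpa using hxW, by simpa using hx0⟩
        | succ j ih =>
          rw [pow_succ', Module.End.mul_apply]
          refine ⟨?_, fun h0 => ih.2 ?_⟩
          · simp only [LinearMap.sub_apply, LinearMap.smul_apply, Module.End.one_apply]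
            exact W.sub_mem (hWst i _ ih.1) (W.smul_mem _ ih.1)
          · have hmem : ((f i - χ i • (1 : Module.End K V)) ^ j) x ∈ N := Submodule.mem_inf.2 ⟨ih.1, LinearMap.mem_ker.2 h0⟩
            rw [hN] at hmem
            exact (Submodule.mem_bot K).1 hmem
      exact (iter n).2 hn
    have hNW : N = W := by
      by_contra hNW
      exact hWmin N ⟨le_trans inf_le_left hWE, hNne, hNst⟩ (lt_of_le_of_ne inf_le_left hNW)
    intro x hxW
    have hxN : x ∈ N := by rw [hNW]; exact hxW
    have h0 := LinearMap.mem_ker.1 (Submodule.mem_inf.1 hxN).2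
    simp only [LinearMap.sub_apply, LinearMap.smul_apply, Module.End.one_apply] at h0
    exact sub_eq_zero.1 h0
  obtain ⟨w, hwW, hw0⟩ := (Submodule.ne_bot_iff W).1 hWne
  exact ⟨w, hw0, hWE hwW, fun i => hkill i w hwW⟩

/-- **JOINT EIGENVECTOR ⇔ BLOCK ≠ 0** (commuting family, any index set, finite dimension): the `χ`-block is non-zero iff there is `w ≠ 0` with `f i w = χ i • w` for
all `i`.  The right-hand side is the body of ★ `Representation.hasJacquetExponent_iff` (eigenvector currency of exponents). [cite: Casselman1995, §4.4 p. 45]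
[cite: BernsteinZelevinsky1977, §2.3] -/
theorem iInf_maxGenEigenspace_ne_bot_iff_exists_eigenvector [FiniteDimensional K V] (f : ι → Module.End K V) (hc : ∀ i j, Commute (f i) (f j)) (χ : ι → K) :
    (⨅ i, (f i).maxGenEigenspace (χ i)) ≠ ⊥ ↔ ∃ w : V, w ≠ 0 ∧ ∀ i, f i w = χ i • w :=
  ⟨fun h => by
    obtain ⟨w, hw0, -, he⟩ := exists_eigenvector_of_iInf_maxGenEigenspace_ne_bot f hc χ h
    exact ⟨w, hw0, he⟩,
   fun ⟨_, hw0, he⟩ => iInf_maxGenEigenspace_ne_bot_of_eigenvector f χ hw0 he⟩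

/-! ## §3 An eigen-functional kills the other blocks -/

/-- **A `χ`-eigen-functional kills every `ψ`-block with `ψ ≠ χ`**: if `Λ (f i v) = χ i * Λ v` for all `i, v` and `v` lies in the `ψ`-block, `ψ ≠ χ`, then `Λ v = 0`
(pick `i` with `ψ i ≠ χ i`; `(f i − ψ i)ⁿ v = 0` gives `(χ i − ψ i)ⁿ Λ v = 0`).  (Functional form of the tree's ★ `eq_zero_of_comp_eq_of_ne`.) [cite: Casselman1995, §4.4 p. 45]
[cite: BernsteinZelevinsky1977, §2.3] -/
theorem eigenFunctional_eq_zero_of_mem_iInf_maxGenEigenspace (f : ι → Module.End K V) (χ : ι → K) (Λ : V →ₗ[K] K) (hΛ : ∀ i v, Λ (f i v) = χ i * Λ v)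
    {ψ : ι → K} (hψ : ψ ≠ χ) {v : V} (hv : v ∈ ⨅ i, (f i).maxGenEigenspace (ψ i)) : Λ v = 0 := by
  obtain ⟨i, hi⟩ : ∃ i, ψ i ≠ χ i := Function.ne_iff.1 hψ
  rw [Module.End.mem_iInf_maxGenEigenspace_iff] at hv
  obtain ⟨n, hn⟩ := hv i
  have h := eigenFunctional_apply_sub_smul_one_pow Λ (hΛ i) (ψ i) n v
  rw [hn, map_zero] at h
  exact (mul_eq_zero.1 h.symm).resolve_left (pow_ne_zero n (sub_ne_zero.2 (Ne.symm hi)))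

/-- Hence a `χ`-eigen-functional kills the span of the other blocks. [cite: Casselman1995, §4.4 p. 45] -/
theorem eigenFunctional_eq_zero_of_mem_iSup_ne (f : ι → Module.End K V) (χ : ι → K) (Λ : V →ₗ[K] K) (hΛ : ∀ i v, Λ (f i v) = χ i * Λ v)
    {v : V} (hv : v ∈ ⨆ (ψ : ι → K) (_ : ψ ≠ χ), ⨅ i, (f i).maxGenEigenspace (ψ i)) : Λ v = 0 := by
  induction hv using Submodule.iSup_induction' with
  | mem ψ x hx =>
    induction hx using Submodule.iSup_induction' with
    | mem hψ x hx => exact eigenFunctional_eq_zero_of_mem_iInf_maxGenEigenspace f χ Λ hΛ hψ hx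
    | zero => exact map_zero Λ
    | add x y _ _ hx hy => rw [map_add, hx, hy, add_zero]
  | zero => exact map_zero Λ
  | add x y _ _ hx hy => rw [map_add, hx, hy, add_zero]

/-! ## §4 Spanning, the complement of a block, surjective image (short-exactness) -/

section Span

variable [IsAlgClosed K]

/-- Over an algebraically closed field the blocks of a commuting family (any index set) SPAN a finite-dimensional space (Mathlib
`iSup_iInf_maxGenEigenspace_eq_top_of_iSup_maxGenEigenspace_eq_top_of_commute` + `iSup_maxGenEigenspace_eq_top`; the tree's ★ `iSup_iInf_maxGenEigenspace_eq_top` is the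
`Finite ι`, any-dimension form). [cite: KnappVogan1995, §VII.2 Prop. 7.20] [cite: Casselman1995, §4.4 p. 45] -/
theorem iSup_iInf_maxGenEigenspace_eq_top_of_finiteDimensional [FiniteDimensional K V] (f : ι → Module.End K V) (hc : ∀ i j, Commute (f i) (f j)) :
    ⨆ χ : ι → K, ⨅ i, (f i).maxGenEigenspace (χ i) = ⊤ :=
  Module.End.iSup_iInf_maxGenEigenspace_eq_top_of_iSup_maxGenEigenspace_eq_top_of_commute f (fun i j _ => hc i j)
    (fun i => Module.End.iSup_maxGenEigenspace_eq_top (f i))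

/-- **The `χ`-block and the span of the other blocks are COMPLEMENTARY** (finite dimension, algebraically closed field, commuting family; independence is the tree's ★
`iSupIndep_iInf_maxGenEigenspace`). [cite: KnappVogan1995, §VII.2 Prop. 7.20] [cite: BernsteinZelevinsky1977, §2.3] -/
theorem isCompl_iInf_maxGenEigenspace_iSup_ne [FiniteDimensional K V] (f : ι → Module.End K V) (hc : ∀ i j, Commute (f i) (f j)) (χ : ι → K) :
    IsCompl (⨅ i, (f i).maxGenEigenspace (χ i)) (⨆ (ψ : ι → K) (_ : ψ ≠ χ), ⨅ i, (f i).maxGenEigenspace (ψ i)) := by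
  refine IsCompl.of_eq (iSupIndep_iInf_maxGenEigenspace f hc χ).eq_bot ?_
  rw [← iSup_iInf_maxGenEigenspace_eq_top_of_finiteDimensional f hc]
  exact (iSup_split_single (fun ψ : ι → K => ⨅ i, (f i).maxGenEigenspace (ψ i)) χ).symm

/-- **Along a SURJECTIVE intertwiner of commuting families (any index set) the image of the `χ`-block IS the `χ`-block** (source finite-dimensional over an
algebraically closed field: its blocks span; the target's blocks are independent; `≤` is ★ functoriality).  The tree's ★ `map_biInf_maxGenEigenspace_eq_of_comp_eq` is the
`Finset`-indexed finite-length form. [cite: BernsteinZelevinsky1977, §2.3] [cite: Casselman1995, §3.2 Prop. 3.2.3, §4.4 p. 45] -/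
theorem map_iInf_maxGenEigenspace_eq_of_comp_eq_of_surjective [FiniteDimensional K V₁] (f₁ : ι → Module.End K V₁) (f₂ : ι → Module.End K V₂)
    (hc₁ : ∀ i j, Commute (f₁ i) (f₁ j)) (hc₂ : ∀ i j, Commute (f₂ i) (f₂ j))
    (G : V₁ →ₗ[K] V₂) (hG : ∀ i, G ∘ₗ f₁ i = f₂ i ∘ₗ G) (hsurj : Function.Surjective G) (χ : ι → K) :
    (⨅ i, (f₁ i).maxGenEigenspace (χ i)).map G = ⨅ i, (f₂ i).maxGenEigenspace (χ i) := by
  refine le_antisymm (map_iInf_maxGenEigenspace_le_of_comp_eq f₁ f₂ G hG χ) (fun y hy => ?_)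
  obtain ⟨x, rfl⟩ := hsurj y
  have hx : x ∈ ⨆ ψ : ι → K, ⨅ i, (f₁ i).maxGenEigenspace (ψ i) := by
    rw [iSup_iInf_maxGenEigenspace_eq_top_of_finiteDimensional f₁ hc₁]; exact Submodule.mem_top
  -- split `x` along the blocks of `V₁`: the `χ`-component `a`, the rest lands in the other blocks of `V₂`
  have key : ∃ a ∈ (⨅ i, (f₁ i).maxGenEigenspace (χ i)), G x - G a ∈ ⨆ (ψ : ι → K) (_ : ψ ≠ χ), ⨅ i, (f₂ i).maxGenEigenspace (ψ i) := by
    refine Submodule.iSup_induction (motive := fun x => ∃ a ∈ (⨅ i, (f₁ i).maxGenEigenspace (χ i)),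
        G x - G a ∈ ⨆ (ψ : ι → K) (_ : ψ ≠ χ), ⨅ i, (f₂ i).maxGenEigenspace (ψ i)) _ hx (fun ψ x hx => ?_) ?_ (fun x y hx hy => ?_)
    · by_cases hψ : ψ = χ
      · subst hψ
        exact ⟨x, hx, by rw [sub_self]; exact Submodule.zero_mem _⟩
      · refine ⟨0, Submodule.zero_mem _, ?_⟩
        rw [map_zero, sub_zero]
        exact Submodule.mem_iSup_of_mem ψ (Submodule.mem_iSup_of_mem hψ (map_iInf_maxGenEigenspace_le_of_comp_eq f₁ f₂ G hG ψ ⟨x, hx, rfl⟩))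
    · exact ⟨0, Submodule.zero_mem _, by rw [sub_self]; exact Submodule.zero_mem _⟩
    · obtain ⟨a, ha, hxa⟩ := hx
      obtain ⟨b, hb, hyb⟩ := hy
      refine ⟨a + b, Submodule.add_mem _ ha hb, ?_⟩
      have : G (x + y) - G (a + b) = (G x - G a) + (G y - G b) := by rw [map_add, map_add]; abel
      rw [this]
      exact Submodule.add_mem _ hxa hyb
  obtain ⟨a, ha, hxa⟩ := key
  have hGa : G a ∈ ⨅ i, (f₂ i).maxGenEigenspace (χ i) := map_iInf_maxGenEigenspace_le_of_comp_eq f₁ f₂ G hG χ ⟨a, ha, rfl⟩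
  have hmem : G x - G a ∈ (⨅ i, (f₂ i).maxGenEigenspace (χ i)) ⊓ ⨆ (ψ : ι → K) (_ : ψ ≠ χ), ⨅ i, (f₂ i).maxGenEigenspace (ψ i) :=
    Submodule.mem_inf.2 ⟨Submodule.sub_mem _ hy hGa, hxa⟩
  rw [(iSupIndep_iInf_maxGenEigenspace f₂ hc₂ χ).eq_bot, Submodule.mem_bot, sub_eq_zero] at hmem
  exact ⟨a, ha, hmem.symm⟩

end Span

/-- Middle exactness: along `V₁ →F V₂ →G V₃` with `Function.Exact F G` and `F` an INJECTIVE intertwiner, an element of the `χ`-block of `V₂` killed by `G` comes from the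
`χ`-block of `V₁` (§1). [cite: BernsteinZelevinsky1977, §2.3] -/
theorem exists_mem_iInf_maxGenEigenspace_map_eq_of_exact (f₁ : ι → Module.End K V₁) (f₂ : ι → Module.End K V₂) (F : V₁ →ₗ[K] V₂) (G : V₂ →ₗ[K] V₃)
    (hF : ∀ i, F ∘ₗ f₁ i = f₂ i ∘ₗ F) (hinj : Function.Injective F) (hex : Function.Exact F G) (χ : ι → K)
    {y : V₂} (hy : y ∈ ⨅ i, (f₂ i).maxGenEigenspace (χ i)) (hGy : G y = 0) :
    ∃ x ∈ (⨅ i, (f₁ i).maxGenEigenspace (χ i)), F x = y := by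
  obtain ⟨x, rfl⟩ := (hex y).1 hGy
  refine ⟨x, ?_, rfl⟩
  rw [iInf_maxGenEigenspace_eq_comap_of_comp_eq_of_injective f₁ f₂ F hF hinj χ]
  exact hy

/-! ## §5 THE EXTENSION LEMMA: a `χ`-eigen-functional of the sub extends when the quotient has no `χ`-eigenvector -/

/-- **EXTENSION OF A `χ`-EIGEN-FUNCTIONAL ALONG A SHORT EXACT SEQUENCE WHOSE QUOTIENT HAS NO `χ`-EIGENVECTOR.**  Let `V₁ →F V₂ →G V₃` be intertwiners of families
`f₁, f₂, f₃` (`F ∘ f₁ i = f₂ i ∘ F`, `G ∘ f₂ i = f₃ i ∘ G`) with `F` injective, `Function.Exact F G`, `G` surjective, `f₂` pairwise commuting and `V₂` finite-dimensional over an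
algebraically closed field.  If `lam : V₁ → K` is a `χ`-eigen-functional (`lam (f₁ i v) = χ i * lam v`) and `V₃` has NO `χ`-eigenvector (`¬ ∃ w ≠ 0, ∀ i, f₃ i w = χ i • w`),
then `lam` extends to a `χ`-eigen-functional `Λ` of `V₂` with `Λ ∘ F = lam`.  Proof: `f₃` commutes and `V₃` is finite-dimensional (pushed along `G`), so the `χ`-block of `V₃`
is `0` (§2) and the `χ`-block of `V₂` is killed by `G`, hence lies in `F(V₁)`; put `Λ := lam ∘ F⁻¹` on it and `Λ := 0` on the complementary span of the other blocks (§4);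
`Λ ∘ F = lam` because `lam` kills the other blocks of `V₁` (§3; `f₁` commutes, pulled back along `F`).  This is the step «the `χ′`-quotient functional of `r_B π′` extends
`T`-equivariantly to `r_B E` when `χ′` is not an exponent of `π`» of the block separation for `0 → π′ → E → π → 0`. [cite: BernsteinZelevinsky1977, §2.3]
[cite: Casselman1995, §4.4 p. 45, §6.3] -/
theorem exists_eigenFunctional_extension [FiniteDimensional K V₂] [IsAlgClosed K]
    (f₁ : ι → Module.End K V₁) (f₂ : ι → Module.End K V₂) (f₃ : ι → Module.End K V₃) (hc₂ : ∀ i j, Commute (f₂ i) (f₂ j))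
    (F : V₁ →ₗ[K] V₂) (G : V₂ →ₗ[K] V₃) (hF : ∀ i, F ∘ₗ f₁ i = f₂ i ∘ₗ F) (hG : ∀ i, G ∘ₗ f₂ i = f₃ i ∘ₗ G)
    (hinj : Function.Injective F) (hex : Function.Exact F G) (hsurj : Function.Surjective G)
    (χ : ι → K) (lam : V₁ →ₗ[K] K) (hlam : ∀ i v, lam (f₁ i v) = χ i * lam v)
    (h₃ : ¬ ∃ w : V₃, w ≠ 0 ∧ ∀ i, f₃ i w = χ i • w) :
    ∃ Λ : V₂ →ₗ[K] K, (∀ i v, Λ (f₂ i v) = χ i * Λ v) ∧ Λ ∘ₗ F = lam := by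
  have hF' : ∀ i v, F (f₁ i v) = f₂ i (F v) := fun i v => LinearMap.congr_fun (hF i) v
  have hG' : ∀ i v, G (f₂ i v) = f₃ i (G v) := fun i v => LinearMap.congr_fun (hG i) v
  -- `V₃` is finite-dimensional and its family commutes (pushed forward along the surjection `G`)
  haveI : FiniteDimensional K V₃ := Module.Finite.of_surjective G hsurj
  have hc₃ : ∀ i j, Commute (f₃ i) (f₃ j) := fun i j => by
    show f₃ i * f₃ j = f₃ j * f₃ i
    refine LinearMap.ext fun w => ?_
    obtain ⟨v, rfl⟩ := hsurj w
    rw [Module.End.mul_apply, Module.End.mul_apply, ← hG' j v, ← hG' i (f₂ j v), ← hG' i v, ← hG' j (f₂ i v),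
      ← Module.End.mul_apply (f₂ i), (hc₂ i j).eq, Module.End.mul_apply]
  -- the `χ`-block of `V₃` vanishes, so the `χ`-block of `V₂` is killed by `G` and sits inside `range F`
  have h₃' : (⨅ i, (f₃ i).maxGenEigenspace (χ i)) = ⊥ := by
    by_contra hne
    obtain ⟨w, hw0, -, he⟩ := exists_eigenvector_of_iInf_maxGenEigenspace_ne_bot f₃ hc₃ χ hne
    exact h₃ ⟨w, hw0, he⟩
  have hker : ∀ y ∈ (⨅ i, (f₂ i).maxGenEigenspace (χ i)), G y = 0 := fun y hy => by
    have := map_iInf_maxGenEigenspace_le_of_comp_eq f₂ f₃ G hG χ ⟨y, hy, rfl⟩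
    rwa [h₃', Submodule.mem_bot] at this
  have hle : (⨅ i, (f₂ i).maxGenEigenspace (χ i)) ≤ LinearMap.range F := fun y hy => (hex y).1 (hker y hy)
  -- `Λ := lam ∘ F⁻¹` on the `χ`-block, `0` on the other blocks
  let e := LinearEquiv.ofInjective F hinj
  let φ : ↥(⨅ i, (f₂ i).maxGenEigenspace (χ i)) →ₗ[K] K := lam ∘ₗ (e.symm : ↥(LinearMap.range F) →ₗ[K] V₁) ∘ₗ Submodule.inclusion hle
  have hφ : ∀ (x : V₁) (hx : F x ∈ ⨅ i, (f₂ i).maxGenEigenspace (χ i)), φ ⟨F x, hx⟩ = lam x := by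
    intro x hx
    show lam (e.symm (Submodule.inclusion hle ⟨F x, hx⟩)) = lam x
    congr 1
    apply e.injective
    rw [LinearEquiv.apply_symm_apply]
    ext
    rfl
  have hcompl := isCompl_iInf_maxGenEigenspace_iSup_ne f₂ hc₂ χ
  refine ⟨LinearMap.ofIsCompl hcompl φ 0, ?_, ?_⟩
  · -- equivariance, block by block of `V₂`
    intro i v
    have hv : v ∈ ⨆ ψ : ι → K, ⨅ j, (f₂ j).maxGenEigenspace (ψ j) := by
      rw [iSup_iInf_maxGenEigenspace_eq_top_of_finiteDimensional f₂ hc₂]; exact Submodule.mem_top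
    induction hv using Submodule.iSup_induction' with
    | mem ψ v hv =>
      have hfv : f₂ i v ∈ ⨅ j, (f₂ j).maxGenEigenspace (ψ j) := apply_mem_iInf_maxGenEigenspace_of_forall_commute f₂ (fun j => hc₂ j i) ψ hv
      by_cases hψ : ψ = χ
      · subst hψ
        -- `v = F x`, `f₂ i v = F (f₁ i x)`, both in the `χ`-block
        obtain ⟨x, -, rfl⟩ := exists_mem_iInf_maxGenEigenspace_map_eq_of_exact f₁ f₂ F G hF hinj hex _ hv (hker _ hv)
        have hx' : F (f₁ i x) ∈ ⨅ j, (f₂ j).maxGenEigenspace (ψ j) := by rw [hF']; exact hfv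
        have h3 : φ ⟨f₂ i (F x), hfv⟩ = φ ⟨F (f₁ i x), hx'⟩ := by congr 1; ext; exact (hF' i x).symm
        rw [LinearMap.ofIsCompl_apply_left hcompl (u := ⟨F x, hv⟩), LinearMap.ofIsCompl_apply_left hcompl (u := ⟨f₂ i (F x), hfv⟩), h3,
          hφ x hv, hφ (f₁ i x) hx', hlam]
      · -- both `v` and `f₂ i v` lie in the complementary span, where `Λ = 0`
        have hv' : v ∈ ⨆ (ψ : ι → K) (_ : ψ ≠ χ), ⨅ j, (f₂ j).maxGenEigenspace (ψ j) := Submodule.mem_iSup_of_mem ψ (Submodule.mem_iSup_of_mem hψ hv)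
        have hfv' : f₂ i v ∈ ⨆ (ψ : ι → K) (_ : ψ ≠ χ), ⨅ j, (f₂ j).maxGenEigenspace (ψ j) := Submodule.mem_iSup_of_mem ψ (Submodule.mem_iSup_of_mem hψ hfv)
        rw [LinearMap.ofIsCompl_apply_right hcompl (v := ⟨v, hv'⟩), LinearMap.ofIsCompl_apply_right hcompl (v := ⟨f₂ i v, hfv'⟩)]
        simp
    | zero => simp
    | add x y _ _ hx hy => rw [map_add, map_add, hx, hy, map_add, mul_add]
  · -- `Λ ∘ F = lam`, block by block of `V₁` (finite-dimensional with commuting family, both pulled back along the injective `F`)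
    haveI : FiniteDimensional K V₁ := Module.Finite.of_injective F hinj
    have hc₁ : ∀ i j, Commute (f₁ i) (f₁ j) := fun i j => by
      show f₁ i * f₁ j = f₁ j * f₁ i
      refine LinearMap.ext fun x => hinj ?_
      rw [Module.End.mul_apply, Module.End.mul_apply, hF', hF', hF', hF', ← Module.End.mul_apply (f₂ i), (hc₂ i j).eq, Module.End.mul_apply]
    ext x
    rw [LinearMap.comp_apply]
    have hx : x ∈ ⨆ ψ : ι → K, ⨅ j, (f₁ j).maxGenEigenspace (ψ j) := by
      rw [iSup_iInf_maxGenEigenspace_eq_top_of_finiteDimensional f₁ hc₁]; exact Submodule.mem_top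
    induction hx using Submodule.iSup_induction' with
    | mem ψ x hx =>
      by_cases hψ : ψ = χ
      · subst hψ
        have hFx : F x ∈ ⨅ j, (f₂ j).maxGenEigenspace (ψ j) := map_iInf_maxGenEigenspace_le_of_comp_eq f₁ f₂ F hF _ ⟨x, hx, rfl⟩
        rw [LinearMap.ofIsCompl_apply_left hcompl (u := ⟨F x, hFx⟩), hφ x hFx]
      · have hFx : F x ∈ ⨆ (ψ : ι → K) (_ : ψ ≠ χ), ⨅ j, (f₂ j).maxGenEigenspace (ψ j) :=
          Submodule.mem_iSup_of_mem ψ (Submodule.mem_iSup_of_mem hψ (map_iInf_maxGenEigenspace_le_of_comp_eq f₁ f₂ F hF _ ⟨x, hx, rfl⟩))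
        rw [LinearMap.ofIsCompl_apply_right hcompl (v := ⟨F x, hFx⟩), LinearMap.zero_apply,
          eigenFunctional_eq_zero_of_mem_iInf_maxGenEigenspace f₁ χ lam hlam hψ hx]
    | zero => simp
    | add x y _ _ hx hy => rw [map_add, map_add, hx, hy, map_add]

end Literature.LinearAlgebra.CommutingFamily
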